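import Mathlib
import Summits.ValiantsHypothesis.ValiantsHypothesis.Theorems.LacunarySymmetroidMatrixDescartesDefiniteMomentsBudgetPlanar
import Summits.ValiantsHypothesis.ValiantsHypothesis.Theorems.LacunarySymmetroidMatrixDescartesDefiniteMomentsZones

/-!
# `MatrixDescartes` (stmt-ValiantsHypothesis-18050) — the DEFINITE-MOMENTS LAW, budget zones IV: zones, alternating scales and
# THE BUDGET LAW `Z₊ ≤ B·m`

HONEST FRAMING.  Cell `pub-symmetroid`, seat `val-sym-mdr-p2` (gen 15); helper file `--supports` the crux
`Theses.LacunarySymmetroid.MatrixDescartes`, NO closure claim.  Verbatim re-run of `…DefiniteMomentsZones` under the abstract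
budget bundle of `…BudgetRayleigh` (budget `B` with multiplicity for every `u`; `#T_u ≥ B` for `u ≠ 0`; one sign `s` near `0⁺`):
root functions `Fin B → ℝ`, continuity, extremal vectors, pairwise order, scales, and the law
**`budget_card_posRoots_le`: `Z₊ ≤ B·card ι`** — the common generalisation of the lacunary Markus theorem (`B = K − 1`,
`budget_of_rayleighSharp`) and of the intrinsic word law (`B` = number of sign changes of a semidefinite word,
`…BudgetWord`).  Nothing here bears on the crux in its window, on `stub_twoSided`, on `DoorA26`/`DoorA34`, registers, or
`VP ≠ VNP`. [folklore]; axioms standard; no definitions.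
-/

-- layout Summits/ValiantsHypothesis/ValiantsHypothesis forces the duplicated namespace component
set_option linter.dupNamespace false

namespace Summit.ValiantsHypothesis.ValiantsHypothesis.Theorems.LacunarySymmetroidMatrixDescartes

open Polynomial Matrix Finset
open scoped BigOperators Topology

namespace DefiniteMoments

/-! ## §1 Root functions -/

section RootFn

variable {ι : Type} [Fintype ι]

/-- **Root functions (budget bundle).**  For a budget-sharp family there is `ρ : (ι → ℝ) → Fin (K−1) → ℝ` such that for every `u ≠ 0`,
`ρ u` is the strictly increasing enumeration of the positive roots of `P_u`. [folklore] -/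
theorem budget_exists_rootFn {K : ℕ} (d : Fin K → ℕ) (S : Fin K → Matrix ι ι ℝ)
    (B : ℕ)
    (hB : ∀ u : ι → ℝ, ((∑ l, C (u ⬝ᵥ (S l *ᵥ u)) * (X : ℝ[X]) ^ d l).roots.filter (fun t => 0 < t)).card ≤ B)
    (hsh : ∀ u : ι → ℝ, u ≠ 0 →
      B ≤ ((∑ l, C (u ⬝ᵥ (S l *ᵥ u)) * (X : ℝ[X]) ^ d l).roots.toFinset.filter (fun t => 0 < t)).card) :
    ∃ ρ : (ι → ℝ) → Fin B → ℝ, ∀ u : ι → ℝ, u ≠ 0 → StrictMono (ρ u) ∧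
      ∀ x : ℝ, x ∈ ((∑ l, C (u ⬝ᵥ (S l *ᵥ u)) * (X : ℝ[X]) ^ d l).roots.toFinset.filter (fun t => 0 < t))
        ↔ ∃ i, ρ u i = x := by
  classical
  refine ⟨fun u => if h : u ≠ 0 then Classical.choose (budget_enum d S B hB hsh u h) else fun _ => 0,
    fun u hu => ?_⟩
  simp only [dif_pos hu]
  exact Classical.choose_spec (budget_enum d S B hB hsh u hu)

/-- Root functions are constant on rays: `ρ (c·u) = ρ u` (`c ≠ 0`). [folklore] -/
theorem budget_rootFn_smul {K : ℕ} (d : Fin K → ℕ) (S : Fin K → Matrix ι ι ℝ) {B : ℕ} (ρ : (ι → ℝ) → Fin B → ℝ)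
    (hρ : ∀ u : ι → ℝ, u ≠ 0 → StrictMono (ρ u) ∧
      ∀ x : ℝ, x ∈ ((∑ l, C (u ⬝ᵥ (S l *ᵥ u)) * (X : ℝ[X]) ^ d l).roots.toFinset.filter (fun t => 0 < t))
        ↔ ∃ i, ρ u i = x)
    {c : ℝ} (hc : c ≠ 0) (u : ι → ℝ) (hu : u ≠ 0) : ρ (c • u) = ρ u := by
  have hcu : c • u ≠ 0 := smul_ne_zero hc hu
  obtain ⟨hm1, hT1⟩ := hρ (c • u) hcu
  obtain ⟨hm2, hT2⟩ := hρ u hu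
  refine enum_unique _ _ _ hm1 hm2 hT1 fun x => ?_
  rw [← hT2 x, posRoots_smul d S hc u]

/-- **Continuity of the root functions on `{u ≠ 0}`** (budget bundle; from `budget_locRoots`: one root per window near `u`). [folklore] -/
theorem budget_rootFn_continuousOn {K : ℕ} (d : Fin K → ℕ) (S : Fin K → Matrix ι ι ℝ)
    (B : ℕ) (hB1 : 1 ≤ B) (s : ℝ)
    (hB : ∀ u : ι → ℝ, ((∑ l, C (u ⬝ᵥ (S l *ᵥ u)) * (X : ℝ[X]) ^ d l).roots.filter (fun t => 0 < t)).card ≤ B)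
    (hsh : ∀ u : ι → ℝ, u ≠ 0 →
      B ≤ ((∑ l, C (u ⬝ᵥ (S l *ᵥ u)) * (X : ℝ[X]) ^ d l).roots.toFinset.filter (fun t => 0 < t)).card)
    (hs : ∀ u : ι → ℝ, u ≠ 0 → ∃ δ : ℝ, 0 < δ ∧ ∀ x : ℝ, 0 < x → x < δ →
      0 < s * (∑ l, C (u ⬝ᵥ (S l *ᵥ u)) * (X : ℝ[X]) ^ d l).eval x)
    (ρ : (ι → ℝ) → Fin B → ℝ)
    (hρ : ∀ u : ι → ℝ, u ≠ 0 → StrictMono (ρ u) ∧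
      ∀ x : ℝ, x ∈ ((∑ l, C (u ⬝ᵥ (S l *ᵥ u)) * (X : ℝ[X]) ^ d l).roots.toFinset.filter (fun t => 0 < t))
        ↔ ∃ i, ρ u i = x)
    (i : Fin B) : ContinuousOn (fun u => ρ u i) {u : ι → ℝ | u ≠ 0} := by
  rw [Metric.continuousOn_iff]
  intro u hu ε hε
  obtain ⟨hmono, hT⟩ := hρ u hu
  have hP0 := budget_ne_zero d S s hs u hu
  have hr0 : ∀ i, 0 < ρ u i := fun i => ((mem_posRoots_iff d S u hP0 _).1 ((hT _).2 ⟨i, rfl⟩)).1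
  obtain ⟨δ, hδ, hδ0, hsep, hδE⟩ := exists_window_radius (ρ u) hmono hr0 {ε} (by simpa using hε)
  obtain ⟨η, hη, hloc⟩ := budget_locRoots d S B hB1 s hB hsh hs u hu (ρ u) hmono hT hδ hδ0 hsep
  refine ⟨η, hη, fun u' hu' hdist => ?_⟩
  obtain ⟨z, hz, hzT⟩ := hloc u' hdist
  obtain ⟨hmono', hT'⟩ := hρ u' hu'
  have heq : ρ u' = z := enum_unique _ (ρ u') z hmono' (strictMono_of_windows (ρ u) z δ hsep hz) hT' hzT
  show dist (ρ u' i) (ρ u i) < ε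
  have hε' := hδE ε (by simp)
  rw [Real.dist_eq, heq, abs_sub_lt_iff]
  constructor <;> linarith [(hz i).1, (hz i).2]

/-- **Extremal vectors.**  For non-empty `ι` each root function attains its maximum and its minimum over `{u ≠ 0}`
(continuity on the compact unit sphere; constancy on rays). [folklore] -/
theorem budget_exists_extremal_vectors [Nonempty ι] {K : ℕ} (d : Fin K → ℕ) (S : Fin K → Matrix ι ι ℝ)
    (B : ℕ) (hB1 : 1 ≤ B) (s : ℝ)
    (hB : ∀ u : ι → ℝ, ((∑ l, C (u ⬝ᵥ (S l *ᵥ u)) * (X : ℝ[X]) ^ d l).roots.filter (fun t => 0 < t)).card ≤ B)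
    (hsh : ∀ u : ι → ℝ, u ≠ 0 →
      B ≤ ((∑ l, C (u ⬝ᵥ (S l *ᵥ u)) * (X : ℝ[X]) ^ d l).roots.toFinset.filter (fun t => 0 < t)).card)
    (hs : ∀ u : ι → ℝ, u ≠ 0 → ∃ δ : ℝ, 0 < δ ∧ ∀ x : ℝ, 0 < x → x < δ →
      0 < s * (∑ l, C (u ⬝ᵥ (S l *ᵥ u)) * (X : ℝ[X]) ^ d l).eval x)
    (ρ : (ι → ℝ) → Fin B → ℝ)
    (hρ : ∀ u : ι → ℝ, u ≠ 0 → StrictMono (ρ u) ∧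
      ∀ x : ℝ, x ∈ ((∑ l, C (u ⬝ᵥ (S l *ᵥ u)) * (X : ℝ[X]) ^ d l).roots.toFinset.filter (fun t => 0 < t))
        ↔ ∃ i, ρ u i = x)
    (i : Fin B) :
    (∃ uM : ι → ℝ, uM ≠ 0 ∧ ∀ u : ι → ℝ, u ≠ 0 → ρ u i ≤ ρ uM i) ∧
      (∃ um : ι → ℝ, um ≠ 0 ∧ ∀ u : ι → ℝ, u ≠ 0 → ρ um i ≤ ρ u i) := by
  set Sph := Metric.sphere (0 : ι → ℝ) 1 with hSph
  have hcpt : IsCompact Sph := isCompact_sphere 0 1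
  have hsub : Sph ⊆ {u : ι → ℝ | u ≠ 0} := by
    intro u hu h0
    rw [hSph, mem_sphere_zero_iff_norm, h0, norm_zero] at hu
    exact zero_ne_one hu
  -- normalisation onto the sphere
  have hnorm : ∀ u : ι → ℝ, u ≠ 0 → ‖u‖⁻¹ • u ∈ Sph ∧ ‖u‖⁻¹ ≠ 0 := by
    intro u hu
    have hn : ‖u‖ ≠ 0 := norm_ne_zero_iff.2 hu
    refine ⟨?_, inv_ne_zero hn⟩
    rw [hSph, mem_sphere_zero_iff_norm, norm_smul, norm_inv, norm_norm, inv_mul_cancel₀ hn]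
  have hne : Sph.Nonempty := by
    have h1 : (fun _ : ι => (1 : ℝ)) ≠ 0 := by
      intro h
      have := congrFun h (Classical.arbitrary ι)
      simp at this
    exact ⟨_, (hnorm _ h1).1⟩
  have hcont : ContinuousOn (fun u => ρ u i) Sph := (budget_rootFn_continuousOn d S B hB1 s hB hsh hs ρ hρ i).mono hsub
  constructor
  · obtain ⟨uM, huM, hmax⟩ := hcpt.exists_isMaxOn hne hcont
    refine ⟨uM, hsub huM, fun u hu => ?_⟩
    obtain ⟨hmem, hc⟩ := hnorm u hu
    have h : ρ (‖u‖⁻¹ • u) i ≤ ρ uM i := hmax hmem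
    rwa [budget_rootFn_smul d S ρ hρ hc u hu] at h
  · obtain ⟨um, hum, hmin⟩ := hcpt.exists_isMinOn hne hcont
    refine ⟨um, hsub hum, fun u hu => ?_⟩
    obtain ⟨hmem, hc⟩ := hnorm u hu
    have h : ρ um i ≤ ρ (‖u‖⁻¹ • u) i := hmin hmem
    rwa [budget_rootFn_smul d S ρ hρ hc u hu] at h

end RootFn

/-! ## §2 Separation of the zones and the alternating scales -/

section Scales

variable {ι : Type} [Fintype ι]

/-- **PAIRWISE ZONE ORDER in root-function form (budget bundle)**: the `i`-th positive root of `P_v` lies strictly below the `(i+1)`-st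
positive root of `P_w`, for all `v, w ≠ 0`. [folklore] -/
theorem budget_root_lt_root_succ {K : ℕ} (d : Fin K → ℕ) (S : Fin K → Matrix ι ι ℝ) (hS : ∀ l, (S l).IsSymm)
    (B : ℕ) (hB1 : 1 ≤ B) (s : ℝ)
    (hB : ∀ u : ι → ℝ, ((∑ l, C (u ⬝ᵥ (S l *ᵥ u)) * (X : ℝ[X]) ^ d l).roots.filter (fun t => 0 < t)).card ≤ B)
    (hsh : ∀ u : ι → ℝ, u ≠ 0 →
      B ≤ ((∑ l, C (u ⬝ᵥ (S l *ᵥ u)) * (X : ℝ[X]) ^ d l).roots.toFinset.filter (fun t => 0 < t)).card)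
    (hs : ∀ u : ι → ℝ, u ≠ 0 → ∃ δ : ℝ, 0 < δ ∧ ∀ x : ℝ, 0 < x → x < δ →
      0 < s * (∑ l, C (u ⬝ᵥ (S l *ᵥ u)) * (X : ℝ[X]) ^ d l).eval x)
    (ρ : (ι → ℝ) → Fin B → ℝ)
    (hρ : ∀ u : ι → ℝ, u ≠ 0 → StrictMono (ρ u) ∧
      ∀ x : ℝ, x ∈ ((∑ l, C (u ⬝ᵥ (S l *ᵥ u)) * (X : ℝ[X]) ^ d l).roots.toFinset.filter (fun t => 0 < t))
        ↔ ∃ i, ρ u i = x)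
    (v w : ι → ℝ) (hv : v ≠ 0) (hw : w ≠ 0) (i j : Fin B) (hij : (j : ℕ) = i + 1) : ρ v i < ρ w j := by
  classical
  by_contra hle
  push Not at hle
  obtain ⟨hmv, hTv⟩ := hρ v hv
  obtain ⟨hmw, hTw⟩ := hρ w hw
  have hPv0 := budget_ne_zero d S s hs v hv
  have hx : 0 < ρ v i := ((mem_posRoots_iff d S v hPv0 _).1 ((hTv _).2 ⟨i, rfl⟩)).1
  have h := budget_zone_pair_count d S hS B hB1 s hB hsh hs v w hv hw hx
  rw [rootsBelow_enum d S v (ρ v) hmv.injective hTv, rootsUpTo_enum d S w (ρ w) hmw.injective hTw,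
    filter_lt_enum (ρ v) hmv i] at h
  have h1 : ((Finset.univ : Finset (Fin B)).filter (fun i' => i' < i)).card = i := by
    have e : (Finset.univ : Finset (Fin B)).filter (fun i' => i' < i) = Finset.Iio i := by ext; simp
    rw [e, Fin.card_Iio]
  have h2 : (j : ℕ) + 1 ≤ ((Finset.univ : Finset (Fin B)).filter (fun i' => ρ w i' ≤ ρ v i)).card := by
    have e : (Finset.Iic j).card = (j : ℕ) + 1 := Fin.card_Iic j
    rw [← e]
    refine Finset.card_le_card fun i' hi' => ?_
    rw [Finset.mem_Iic] at hi'
    rw [Finset.mem_filter]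
    exact ⟨Finset.mem_univ _, (hmw.monotone hi').trans hle⟩
  omega

/-- **One alternating scale per gap (budget bundle).**  For non-empty `ι` and every `j ≤ B` there is a scale `a > 0` at which EVERY
Rayleigh `K`-nomial `P_u` (`u ≠ 0`) has exactly `j` roots below `a` and does not vanish: `a` lies above the maximum of the
`j`-th zone and below the minimum of the `(j+1)`-st. [folklore] -/
theorem budget_exists_scale [Nonempty ι] {K : ℕ} (d : Fin K → ℕ) (S : Fin K → Matrix ι ι ℝ) (hS : ∀ l, (S l).IsSymm)
    (B : ℕ) (hB1 : 1 ≤ B) (s : ℝ)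
    (hB : ∀ u : ι → ℝ, ((∑ l, C (u ⬝ᵥ (S l *ᵥ u)) * (X : ℝ[X]) ^ d l).roots.filter (fun t => 0 < t)).card ≤ B)
    (hsh : ∀ u : ι → ℝ, u ≠ 0 →
      B ≤ ((∑ l, C (u ⬝ᵥ (S l *ᵥ u)) * (X : ℝ[X]) ^ d l).roots.toFinset.filter (fun t => 0 < t)).card)
    (hs : ∀ u : ι → ℝ, u ≠ 0 → ∃ δ : ℝ, 0 < δ ∧ ∀ x : ℝ, 0 < x → x < δ →
      0 < s * (∑ l, C (u ⬝ᵥ (S l *ᵥ u)) * (X : ℝ[X]) ^ d l).eval x)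
    (j : ℕ) (hj : j ≤ B) :
    ∃ a : ℝ, 0 < a ∧ ∀ u : ι → ℝ, u ≠ 0 →
      ((∑ l, C (u ⬝ᵥ (S l *ᵥ u)) * (X : ℝ[X]) ^ d l).roots.toFinset.filter (fun t => 0 < t ∧ t < a)).card = j ∧
        u ⬝ᵥ ((∑ k, a ^ d k • S k) *ᵥ u) ≠ 0 := by
  classical
  obtain ⟨ρ, hρ⟩ := budget_exists_rootFn d S B hB hsh
  have hpos : ∀ u : ι → ℝ, u ≠ 0 → ∀ i, 0 < ρ u i := fun u hu i =>
    ((mem_posRoots_iff d S u (budget_ne_zero d S s hs u hu) _).1 (((hρ u hu).2 _).2 ⟨i, rfl⟩)).1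
  -- lower barrier: above all `i`-th roots with `i < j`; upper barrier: below all `i`-th roots with `j ≤ i`
  obtain ⟨lo, up, hlo0, hloup, hup0, hlo, hup⟩ : ∃ lo up : ℝ, 0 ≤ lo ∧ lo < up ∧ 0 < up ∧
      (∀ u : ι → ℝ, u ≠ 0 → ∀ i : Fin B, (i : ℕ) < j → ρ u i ≤ lo) ∧
      (∀ u : ι → ℝ, u ≠ 0 → ∀ i : Fin B, j ≤ (i : ℕ) → up ≤ ρ u i) := by
    by_cases hj0 : j = 0
    · -- lowest gap: below the minimum of the first zone
      subst hj0
      have i0 : Fin B := ⟨0, by omega⟩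
      obtain ⟨-, ⟨um, hum, hmin⟩⟩ := budget_exists_extremal_vectors d S B hB1 s hB hsh hs ρ hρ ⟨0, by omega⟩
      refine ⟨0, ρ um ⟨0, by omega⟩, le_rfl, hpos um hum _, hpos um hum _, fun u hu i hi => absurd hi (Nat.not_lt_zero _),
        fun u hu i _ => (hmin u hu).trans ((hρ u hu).1.monotone (Fin.mk_le_mk.2 (Nat.zero_le _)))⟩
    · obtain ⟨⟨uM, huM, hmax⟩, -⟩ := budget_exists_extremal_vectors d S B hB1 s hB hsh hs ρ hρ ⟨j - 1, by omega⟩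
      have hloall : ∀ u : ι → ℝ, u ≠ 0 → ∀ i : Fin B, (i : ℕ) < j → ρ u i ≤ ρ uM ⟨j - 1, by omega⟩ :=
        fun u hu i hi => ((hρ u hu).1.monotone (Fin.mk_le_mk.2 (by omega))).trans (hmax u hu)
      by_cases hjn : j = B
      · -- highest gap: above the maximum of the last zone
        refine ⟨ρ uM ⟨j - 1, by omega⟩, ρ uM ⟨j - 1, by omega⟩ + 1, (hpos uM huM _).le, by linarith,
          by linarith [hpos uM huM ⟨j - 1, by omega⟩], hloall, fun u hu i hi => ?_⟩
        have := i.isLt; omega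
      · -- interior gap: between the maximum of zone `j-1` and the minimum of zone `j`
        obtain ⟨-, ⟨um, hum, hmin⟩⟩ := budget_exists_extremal_vectors d S B hB1 s hB hsh hs ρ hρ ⟨j, by omega⟩
        have hsep : ρ uM ⟨j - 1, by omega⟩ < ρ um ⟨j, by omega⟩ :=
          budget_root_lt_root_succ d S hS B hB1 s hB hsh hs ρ hρ uM um huM hum _ _ (by simp only []; omega)
        refine ⟨ρ uM ⟨j - 1, by omega⟩, ρ um ⟨j, by omega⟩, (hpos uM huM _).le, hsep, hpos um hum _, hloall,
          fun u hu i hi => (hmin u hu).trans ((hρ u hu).1.monotone (Fin.mk_le_mk.2 hi))⟩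
  refine ⟨(lo + up) / 2, by linarith, fun u hu => ?_⟩
  obtain ⟨hmono, hT⟩ := hρ u hu
  have hiff : ∀ i : Fin B, ρ u i < (lo + up) / 2 ↔ (i : ℕ) < j := by
    intro i
    constructor
    · intro h
      by_contra hge
      push Not at hge
      have := hup u hu i hge
      linarith
    · intro h
      have := hlo u hu i h
      linarith
  have hne : ∀ i : Fin B, ρ u i ≠ (lo + up) / 2 := by
    intro i h
    by_cases hi : (i : ℕ) < j
    · have := hlo u hu i hi; linarith
    · push Not at hi; have := hup u hu i hi; linarith
  constructor
  · rw [rootsBelow_enum d S u (ρ u) hmono.injective hT, ← card_filter_val_lt B j hj]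
    congr 1
    ext i
    simp only [Finset.mem_filter, Finset.mem_univ, true_and, hiff]
  · intro h0
    have hP0 := budget_ne_zero d S s hs u hu
    obtain ⟨i, hi⟩ := (hT _).1 ((mem_posRoots_iff d S u hP0 _).2 ⟨by linarith, h0⟩)
    exact hne i hi

/-- **ALTERNATING SCALES EXIST under the budget bundle (`B ≥ 1`).**  There are scales `0 < a₀ < ⋯ < a_B` with
`s·(−1)ʲ·vᵀF(aⱼ)v > 0` for every `v ≠ 0`. [folklore] -/
theorem budget_exists_alternatingScales {K : ℕ} (d : Fin K → ℕ) (S : Fin K → Matrix ι ι ℝ) (hS : ∀ l, (S l).IsSymm)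
    (B : ℕ) (hB1 : 1 ≤ B) (s : ℝ)
    (hB : ∀ u : ι → ℝ, ((∑ l, C (u ⬝ᵥ (S l *ᵥ u)) * (X : ℝ[X]) ^ d l).roots.filter (fun t => 0 < t)).card ≤ B)
    (hsh : ∀ u : ι → ℝ, u ≠ 0 →
      B ≤ ((∑ l, C (u ⬝ᵥ (S l *ᵥ u)) * (X : ℝ[X]) ^ d l).roots.toFinset.filter (fun t => 0 < t)).card)
    (hs : ∀ u : ι → ℝ, u ≠ 0 → ∃ δ : ℝ, 0 < δ ∧ ∀ x : ℝ, 0 < x → x < δ →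
      0 < s * (∑ l, C (u ⬝ᵥ (S l *ᵥ u)) * (X : ℝ[X]) ^ d l).eval x) :
    ∃ a : Fin (B + 1) → ℝ, StrictMono a ∧ 0 < a 0 ∧
      ∀ (j : Fin (B + 1)) (v : ι → ℝ), v ≠ 0 → 0 < s * (-1) ^ (j : ℕ) * (v ⬝ᵥ ((∑ k, a j ^ d k • S k) *ᵥ v)) := by
  classical
  rcases isEmpty_or_nonempty ι with hι | hι
  · refine ⟨fun j => (j : ℝ) + 1, fun i j h => ?_, by simp, fun j v hv => absurd (Subsingleton.elim v 0) hv⟩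
    have h' : (i : ℕ) < (j : ℕ) := h
    show (i : ℝ) + 1 < (j : ℝ) + 1
    exact_mod_cast Nat.succ_lt_succ h'
  · have hv₀ : (fun _ : ι => (1 : ℝ)) ≠ 0 := by
      intro h
      have := congrFun h (Classical.arbitrary ι)
      simp at this
    have hsc : ∀ j : Fin (B + 1), ∃ a : ℝ, 0 < a ∧ ∀ u : ι → ℝ, u ≠ 0 →
        ((∑ l, C (u ⬝ᵥ (S l *ᵥ u)) * (X : ℝ[X]) ^ d l).roots.toFinset.filter (fun t => 0 < t ∧ t < a)).card = j ∧
          u ⬝ᵥ ((∑ k, a ^ d k • S k) *ᵥ u) ≠ 0 :=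
      fun j => budget_exists_scale d S hS B hB1 s hB hsh hs j (by have := j.isLt; omega)
    choose a ha0 ha using hsc
    refine ⟨a, fun i j hij => ?_, ha0 0, fun j v hv => ?_⟩
    · by_contra hle
      push Not at hle
      have h1 := (ha i _ hv₀).1
      have h2 := (ha j _ hv₀).1
      have hmono := card_rootsBelow_mono (∑ l, C ((fun _ : ι => (1 : ℝ)) ⬝ᵥ (S l *ᵥ fun _ : ι => (1 : ℝ)))
        * (X : ℝ[X]) ^ d l) hle
      rw [h1, h2] at hmono
      exact absurd hmono (not_le.2 hij)
    · obtain ⟨hcount, hne⟩ := ha j v hv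
      have hnr : ¬ (∑ l, C (v ⬝ᵥ (S l *ᵥ v)) * (X : ℝ[X]) ^ d l).IsRoot (a j) :=
        fun h => hne ((isRoot_iff_form_eq_zero d S v (a j)).1 h)
      have h := budget_sign_law d S B s hB hsh hs v hv (ha0 j) hnr
      rwa [hcount] at h

/-- **THE BUDGET LAW.**  Under the bundle (budget `B` with multiplicity for every `u`, `#T_u ≥ B` for `u ≠ 0`, one sign near
`0⁺`) and with symmetric letters: `det F` has at most `B·card ι` distinct positive zeros.  (`B ≥ 1`: alternating scales +
Theorem B `card_posRoots_le_of_definiteMoments`; `B = 0`: `F(x)` is definite for every `x > 0`.) [folklore] -/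
theorem budget_card_posRoots_le [DecidableEq ι] {K : ℕ} (d : Fin K → ℕ) (S : Fin K → Matrix ι ι ℝ)
    (hS : ∀ l, (S l).IsSymm)
    (B : ℕ) (s : ℝ)
    (hB : ∀ u : ι → ℝ, ((∑ l, C (u ⬝ᵥ (S l *ᵥ u)) * (X : ℝ[X]) ^ d l).roots.filter (fun t => 0 < t)).card ≤ B)
    (hsh : ∀ u : ι → ℝ, u ≠ 0 →
      B ≤ ((∑ l, C (u ⬝ᵥ (S l *ᵥ u)) * (X : ℝ[X]) ^ d l).roots.toFinset.filter (fun t => 0 < t)).card)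
    (hs : ∀ u : ι → ℝ, u ≠ 0 → ∃ δ : ℝ, 0 < δ ∧ ∀ x : ℝ, 0 < x → x < δ →
      0 < s * (∑ l, C (u ⬝ᵥ (S l *ᵥ u)) * (X : ℝ[X]) ^ d l).eval x) :
    ((Matrix.det (∑ k, ((X : ℝ[X]) ^ d k) • (S k).map C)).roots.toFinset.filter (fun t => 0 < t)).card
      ≤ B * Fintype.card ι := by
  classical
  rcases Nat.eq_zero_or_pos B with hB0 | hB1
  · -- no positive root at all: every `F(x)`, `x > 0`, is definite
    subst hB0
    rw [zero_mul, Nat.le_zero, Finset.card_eq_zero, Finset.filter_eq_empty_iff]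
    intro x hx hx0
    have hdet := det_eval_eq_zero_of_mem d S hx
    obtain ⟨v, hv, hFv⟩ := Matrix.exists_mulVec_eq_zero_iff.2 hdet
    have hP0 := budget_ne_zero d S s hs v hv
    have hT0 : ((∑ l, C (v ⬝ᵥ (S l *ᵥ v)) * (X : ℝ[X]) ^ d l).roots.toFinset.filter (fun t => 0 < t)).card = 0 :=
      Nat.le_zero.1 (budget_card_le d S 0 hB v)
    have hnr : ¬ (∑ l, C (v ⬝ᵥ (S l *ᵥ v)) * (X : ℝ[X]) ^ d l).IsRoot x := by
      intro h
      have hmem : x ∈ (∑ l, C (v ⬝ᵥ (S l *ᵥ v)) * (X : ℝ[X]) ^ d l).roots.toFinset.filter (fun t => 0 < t) := by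
        rw [Finset.mem_filter, Multiset.mem_toFinset, mem_roots hP0]; exact ⟨h, hx0⟩
      rw [Finset.card_eq_zero] at hT0
      rw [hT0] at hmem
      exact Finset.notMem_empty x hmem
    have hsign := budget_sign_law d S 0 s hB hsh hs v hv hx0 hnr
    rw [hFv, dotProduct_zero, mul_zero] at hsign
    exact lt_irrefl 0 hsign
  · obtain ⟨a, ha, ha0, hdef⟩ := budget_exists_alternatingScales d S hS B hB1 s hB hsh hs
    exact card_posRoots_le_of_definiteMoments d S hS B a ha ha0 s hdef
      (fun v hv T hT => budget_form_le d S B s hB hs v hv T hT)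

end Scales

end DefiniteMoments

end Summit.ValiantsHypothesis.ValiantsHypothesis.Theorems.LacunarySymmetroidMatrixDescartes
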